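import Summits.BirchSwinnertonDyer.Rank1Residual.X11b.AnticyclotomicTamagawa
import Summits.BirchSwinnertonDyer.Rank1Residual.X11b.Three.RouteR1TamagawaPlaces
import HarnessLib

/-!
# X11b at `p = 3`, route R1 — the link (TAM-q) `ord_p ∏_{w ∣ N⁺} c_w(E/K) = ord_p ∏_w c_w(E/K)` on an erratum field at every ODD prime `p` (cell `b2b-bsdres`, team `x11b3`, seat p6, item (O-p6-f) = S8♮)

HONEST FRAMING (cell `b2b-bsdres`, run/shared/lean/b2b/bsd-rank1-residual/, verbatim in every
file): the goal of the cell is to DELETE the COMBINATION-SHAPED residual classes of the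
Birch–Swinnerton-Dyer formula for ALL analytic-rank `≤ 1` elliptic curves over `ℚ` — "full BSD
formula for every rank `≤ 1` curve in class `C`" assembled STRICTLY from published theorems — so
that the rank-`≤ 1` remainder becomes exactly the CONSTRUCTION-SHAPED classes, which are TYPED
(missing-input `Prop`s), NOT attempted. This is not "finishing BSD". Team `x11b3` (N8/O2: X11b at
`p = 3`); a RESEARCH ROUTE; no claim beyond the stated class; X11 ∧ `r = 1` at `p = 3` stays
CONSTRUCTION-SHAPED / O2 OPEN; nothing here books anything or changes a label. THEOREMS ONLY (no
`def`, no named fact, no `sorry`).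

## What this file proves

multr1-p1's `padicValNat_tamagawaProductSplit_eq_of_isErratumField` (`X11b/AnticyclotomicTamagawa.lean`)
— the link (TAM-q) of Castella, Camb. J. Math. 6 (2018) §5, "(5.2) can be rewritten as (5.3)":
`ord_p ∏_{w ∣ N⁺} c_w(E/K) = ord_p ∏_w c_w(E/K)` on an erratum field — carries `5 ≤ p`, because its
proof runs through the gen-2 per-place fibre identity whose non-split case uses "`c ≤ 4 < p`". Here
the same identity is proved at EVERY ODD `p` and EVERY ramified-representation prime `q` (the prime
`q = 2` included), for `W/ℚ` globally minimal elliptic, `q` multiplicative with `p ∤ ord_q(Δ_min)` and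
`K` an erratum field for `q` (every prime of `N_E` other than `q` splits in `K`), by a DIRECT local
argument that never meets a twist or an additive place: a place `w` of `K` off `N⁺` lies either over
a prime `ℓ ∤ N_E` — then `E_K` has good reduction at `w` and `c_w = 1` — or over a bad prime that
does not split in `K`, which on an erratum field is `ℓ = q`; there `E_K` has MULTIPLICATIVE reduction
at `w` (base change of a multiplicative prime, `isMinimalAt_and_hasMultiplicativeReductionAt_baseChange_of_mult`)
with `ord_w(j) = −e(w|q)·ord_q(Δ_min)`, `e(w|q) ≤ 2 < p` (`jHyp_baseChange`), so `c_w = ord_w(Δ_min)`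
(split) or `c_w ∈ {1, 2}` (non-split) is a `p`-unit (seat p6's odd-`p` unit criterion
`padicValNat_localTamagawaNumber_eq_zero_of_semistable`, `Three/RouteR1TamagawaPlaces.lean`).

* `exists_ramificationIdx_pos_le_two` — a place of a quadratic field has ramification index `1` or
  `2` over `ℚ` (bookkeeping from the tree's `placesOver_trichotomy_of_finrank_eq_two`);
* `padicValNat_localTamagawaNumber_baseChange_eq_zero_off_split` — the off-`N⁺` unit statement above;
* **`padicValNat_tamagawaProductSplit_eq_of_isErratumField_odd`** — (TAM-q) at every odd `p`, every `q`.

Use (file `Three/RouteR1LowerFromDivisibility.lean`): the `p = 3` twin of multr1-p2's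
`display53Lower_of_imcDivIntFrameAtErratumData` (gen 28), whose last step is exactly (TAM-q).
Elementary local arithmetic; nothing about STEP L itself.

References: [Castella2018] §5 (arXiv:1704.06608 p. 12), from (5.2) to (5.3); [SilvermanAEC2009]
VII.2 (remark after Prop. 2.1), VII.5 Prop. 5.1 (b), VII.6 Thm. 6.1 (Kodaira–Néron);
[SilvermanATAEC1994] IV.9.4 Step 2; [JetchevSkinnerWan2017] §7.3.1 (eq:tamK).
-/

noncomputable section

open scoped Classical

open WeierstrassCurve NumberField IsDedekindDomain Literature.NumberTheory.EllipticCurves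
  Literature.NumberTheory.EllipticCurves.Rank1Residual

namespace Summit.BirchSwinnertonDyer.Rank1Residual.X11b.Three

/-! ### Bookkeeping: ramification indices in a quadratic field -/

/-- In a quadratic field every finite place `w` has ramification index `1` or `2` over the rational
place below it (the fundamental identity `Σ e·f = 2`; tree `placesOver_trichotomy_of_finrank_eq_two`).
[folklore] -/
theorem exists_ramificationIdx_pos_le_two (K : Type) [Field K] [NumberField K]
    (h2 : Module.finrank ℚ K = 2) (w : HeightOneSpectrum (𝓞 K)) :
    ∃ e : ℕ, w.asIdeal.ramificationIdx (𝓞 ℚ) = e ∧ 0 < e ∧ e ≤ 2 := by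
  rcases placesOver_trichotomy_of_finrank_eq_two K h2 (w.under (𝓞 ℚ)) with
    ⟨w₁, w₂, -, -, hef⟩ | ⟨w', hset, he', -⟩ | ⟨w', hset, he', -⟩
  · exact ⟨1, (hef w rfl).1, one_pos, by norm_num⟩
  · have hw : w ∈ ({w'} : Set (HeightOneSpectrum (𝓞 K))) := by
      rw [← hset]; exact rfl
    rw [Set.mem_singleton_iff] at hw
    subst hw
    exact ⟨1, he', one_pos, by norm_num⟩
  · have hw : w ∈ ({w'} : Set (HeightOneSpectrum (𝓞 K))) := by
      rw [← hset]; exact rfl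
    rw [Set.mem_singleton_iff] at hw
    subst hw
    exact ⟨2, he', two_pos, le_rfl⟩

/-! ### Off `N⁺` every local Tamagawa number of `E_K` is a `p`-unit (odd `p`, erratum field) -/

section OffSplit

variable (W : WeierstrassCurve ℚ) [W.IsElliptic] [W.IsGloballyMinimal] (p : ℕ) [Fact p.Prime]
  (K : Type) [Field K] [NumberField K]

/-- **Off `N⁺`, `p ∤ c_w(E/K)` (odd `p`, erratum field, any `q`).** For `W/ℚ` globally minimal
elliptic, `p` odd, `q` a multiplicative prime with `p ∤ ord_q(Δ_min)`, `K` an erratum field for `q`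
and a finite place `w` of `K` that does NOT lie over a prime of `N_E` split in `K`:
`ord_p c_w(E_K) = 0`. The place lies over `ℓ ∤ N_E` (good reduction of `E`, hence of `E_K` at `w`:
`c_w = 1`) or over a non-split bad prime, which is `q` (erratum field); there `E_K` is multiplicative
at `w` with `ord_w(j) = −e(w|q)·ord_q(Δ_min)`, `e ≤ 2 < p`, so `c_w ∈ {ord_w(Δ_min)} ∪ {1, 2}` is a
`p`-unit. No twist and no additive place enter — which is why `q = 2` is allowed.
[cite: Castella2018, §5 (arXiv:1704.06608 p. 12), "ord_p(c_w(E/K)) = 0 for every prime w ∣ q"]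
[cite: SilvermanAEC2009, Thm VII.6.1] [cite: SilvermanATAEC1994, IV.9.4 Step 2 (PDF p. 344)] -/
theorem padicValNat_localTamagawaNumber_baseChange_eq_zero_off_split (hp2 : p ≠ 2)
    {q : ℕ} [Fact q.Prime] (hmq : Mult W q) (hvq : ¬ p ∣ padicValInt q W.minimalDiscriminantInt)
    (hK : IsErratumField W K q) (w : HeightOneSpectrum (𝓞 K))
    (hw : ¬ IsPlaceOverSplitConductorPrime W K w) :
    padicValNat p (((W.baseChange K).baseChange (w.adicCompletion K)).localTamagawaNumber
      (w.adicCompletionIntegers K)) = 0 := by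
  have hpr : p.Prime := Fact.out
  have hqP : q.Prime := Fact.out
  haveI hEK : (W.baseChange K).IsElliptic := by rw [baseChange]; infer_instance
  have h2 : Module.finrank ℚ K = 2 := hK.1.1
  set v : HeightOneSpectrum (𝓞 ℚ) := w.under (𝓞 ℚ) with hvdef
  set ℓ : ℕ := (Rat.HeightOneSpectrum.primesEquiv v : ℕ) with hℓdef
  haveI hℓ : Fact ℓ.Prime := ⟨(Rat.HeightOneSpectrum.primesEquiv v).2⟩
  have hvℓ : (Rat.HeightOneSpectrum.primesEquiv v : ℕ) = ℓ := rfl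
  haveI : w.asIdeal.LiesOver v.asIdeal := ⟨by rw [hvdef]; rfl⟩
  -- the ramification index `e(w|v) ∈ {1, 2}`, so `e < p`
  obtain ⟨e, he, he0, he2⟩ := exists_ramificationIdx_pos_le_two K h2 w
  have hep : e < p := lt_of_le_of_lt he2 (by have := hpr.two_le; omega)
  -- a bad `ℓ` under `w` does not split in `K` (else `w ∣ N⁺`), hence is the ramified prime `q`
  have hℓq : ℓ ∣ W.conductorNorm ℤ → ℓ = q := fun hℓN => by
    by_contra hne
    exact hw ⟨hK.2.2.1 ℓ hℓ.out hℓN hne, hℓN⟩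
  -- the `p`-adic `j`-hypothesis at `v`
  have H : ∀ n : ℕ, 0 < n → v.valuation ℚ W.j = WithZero.exp (n : ℤ) → ¬ p ∣ n := by
    by_cases hℓN : ℓ ∣ W.conductorNorm ℤ
    · have hmv : W.HasMultiplicativeReductionAt v :=
        (hasMultiplicativeReductionAtPrime_primesEquiv_iff_holds W v q (hℓq hℓN)).mp hmq
      intro n hn hval
      rw [valuation_j_eq_exp_ordMinimalDiscriminant v W hmv, WithZero.exp_inj] at hval
      have hn' : n = W.ordMinimalDiscriminant v := by exact_mod_cast hval.symm
      rw [hn', ordMinimalDiscriminant_eq_padicValInt W v (hℓq hℓN)]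
      exact hvq
    · have hgood : W.HasGoodReductionAt v :=
        (hasGoodReductionAtPrime_primesEquiv_iff_holds W v ℓ hvℓ).mp
          (by
            by_contra hbad'
            exact hℓN ((W.dvd_conductorNorm_iff_not_hasGoodReductionAtPrime ℓ).mpr hbad'))
      have hj := Additive.valuation_j_le_one_of_hasGoodReductionAt W v hgood
      intro n hn hval
      exfalso
      rw [hval, ← WithZero.exp_zero, WithZero.exp_le_exp] at hj
      omega
  -- `E_K` is semistable at `w`
  have hsemiK : (W.baseChange K).HasGoodReductionAt w ∨
      (W.baseChange K).HasMultiplicativeReductionAt w := by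
    by_cases hℓN : ℓ ∣ W.conductorNorm ℤ
    · -- `w ∣ q`: multiplicative reduction is stable under base change
      have hvq' : v = (Rat.HeightOneSpectrum.primesEquiv (R := 𝓞 ℚ)).symm ⟨q, hqP⟩ := by
        rw [Equiv.eq_symm_apply]; exact Subtype.ext (hℓq hℓN)
      have hqv : (q : 𝓞 ℚ) ∈ v.asIdeal :=
        (natCast_mem_asIdeal_iff_eq_primesEquiv_symm v hqP).mpr hvq'
      have hmem : (q : 𝓞 ℚ) ∈ (w.under (𝓞 ℚ)).asIdeal := by rw [← hvdef]; exact hqv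
      rw [HeightOneSpectrum.under_asIdeal, Ideal.under_def, Ideal.mem_comap, map_natCast] at hmem
      exact Or.inr
        (Additive.isMinimalAt_and_hasMultiplicativeReductionAt_baseChange_of_mult W hmq w hmem).2
    · have hgood : W.HasGoodReductionAt v :=
        (hasGoodReductionAtPrime_primesEquiv_iff_holds W v ℓ hvℓ).mp
          (by
            by_contra hbad'
            exact hℓN ((W.dvd_conductorNorm_iff_not_hasGoodReductionAtPrime ℓ).mpr hbad'))
      exact Or.inl (hasGoodReductionAt_baseChange_of_hasGoodReductionAt_rat W v w hgood)
  exact padicValNat_localTamagawaNumber_eq_zero_of_semistable (W.baseChange K) w hp2 hsemiK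
    (jHyp_baseChange W K w v hvdef.symm hpr he he0 hep H)

end OffSplit

/-! ### (TAM-q) at every odd `p` -/

section TamQ

/-- `ord_p` of a finite product of non-zero naturals is the sum of the `ord_p`. [folklore] -/
private theorem padicValNat_finsetProd_odd {ι : Type*} (p : ℕ) [Fact p.Prime] (s : Finset ι)
    (f : ι → ℕ) (hf : ∀ i ∈ s, f i ≠ 0) :
    padicValNat p (∏ i ∈ s, f i) = ∑ i ∈ s, padicValNat p (f i) := by
  classical
  induction s using Finset.induction_on with
  | empty => simp
  | insert a s ha ih =>
    rw [Finset.prod_insert ha, Finset.sum_insert ha,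
      padicValNat.mul (hf a (Finset.mem_insert_self a s))
        (Finset.prod_ne_zero_iff.mpr fun i hi => hf i (Finset.mem_insert_of_mem hi)),
      ih fun i hi => hf i (Finset.mem_insert_of_mem hi)]

variable (W : WeierstrassCurve ℚ) [W.IsElliptic] [W.IsGloballyMinimal] (p : ℕ) [Fact p.Prime]
  (K : Type) [Field K] [NumberField K]

/-- **(TAM-q) on every erratum field at every ODD `p`: `ord_p ∏_{w ∣ N⁺} c_w(E/K) =
ord_p ∏_w c_w(E/K)`.** For `W/ℚ` globally minimal elliptic, `p ≠ 2`, `q` a multiplicative prime with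
`p ∤ ord_q(Δ_min)` (`E[p]` ramified at `q`) and `K` an erratum field for `q` (every prime of `N_E`
other than `q` splits in `K`): the places of `K` off `N⁺` contribute `p`-units
(`padicValNat_localTamagawaNumber_baseChange_eq_zero_off_split`). The `p ≥ 5` statement is
multr1-p1's `padicValNat_tamagawaProductSplit_eq_of_isErratumField`; this is the same identity with
`5 ≤ p` weakened to `p ≠ 2` (and no parity condition on `q`). Castella §5: "Since `E[p]` is ramified at
`q`, we have `ord_p(c_w(E/K)) = 0` for every prime `w ∣ q` … (5.2) can be rewritten as (5.3)".
[cite: Castella2018, §5 (arXiv:1704.06608 p. 12), from (5.2) to (5.3)]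
[cite: JetchevSkinnerWan2017, §7.3.1 (eq:tamK)] -/
theorem padicValNat_tamagawaProductSplit_eq_of_isErratumField_odd (hp2 : p ≠ 2) {q : ℕ}
    [Fact q.Prime] (hmq : Mult W q) (hvq : ¬ p ∣ padicValInt q W.minimalDiscriminantInt)
    (hK : IsErratumField W K q) :
    padicValNat p (tamagawaProductSplit W K) = padicValNat p (W.baseChange K).tamagawaProduct := by
  haveI hEK : (W.baseChange K).IsElliptic := by rw [baseChange]; infer_instance
  -- the local Tamagawa function over `K` and its restriction to `N⁺`
  set cK : HeightOneSpectrum (𝓞 K) → ℕ := fun w =>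
    ((W.baseChange K).baseChange (w.adicCompletion K)).localTamagawaNumber
      (w.adicCompletionIntegers K) with hcK
  set g : HeightOneSpectrum (𝓞 K) → ℕ := fun w =>
    if IsPlaceOverSplitConductorPrime W K w then cK w else 1 with hg
  have hcK0 : ∀ w, cK w ≠ 0 := fun w => (W.baseChange K).localTamagawaNumber_baseChange_ne_zero w
  have hg0 : ∀ w, g w ≠ 0 := fun w => by
    by_cases h : IsPlaceOverSplitConductorPrime W K w
    · rw [hg]; simp only [h, if_true]; exact hcK0 w
    · rw [hg]; simp only [h, if_false]; exact one_ne_zero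
  have hfinK : (Function.mulSupport cK).Finite :=
    (W.baseChange K).mulSupport_localTamagawaNumber_finite_holds
  set SK : Finset (HeightOneSpectrum (𝓞 K)) := hfinK.toFinset with hSK
  have hsubK : Function.mulSupport cK ⊆ ↑SK := by
    intro w hw
    exact hfinK.mem_toFinset.mpr hw
  have hsubg : Function.mulSupport g ⊆ ↑SK := by
    intro w hw
    apply hsubK
    rw [Function.mem_mulSupport] at hw ⊢
    by_cases h : IsPlaceOverSplitConductorPrime W K w
    · rw [hg] at hw; simp only [h, if_true] at hw; exact hw
    · rw [hg] at hw; simp only [h, if_false] at hw; exact (hw rfl).elim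
  -- both valuations as sums over `SK`
  have hK' : padicValNat p (W.baseChange K).tamagawaProduct = ∑ w ∈ SK, padicValNat p (cK w) := by
    rw [show (W.baseChange K).tamagawaProduct = ∏ᶠ w, cK w from rfl,
      finprod_eq_prod_of_mulSupport_subset cK hsubK]
    exact padicValNat_finsetProd_odd p SK cK fun w _ => hcK0 w
  have hg' : padicValNat p (tamagawaProductSplit W K) = ∑ w ∈ SK, padicValNat p (g w) := by
    rw [show tamagawaProductSplit W K = ∏ᶠ w, g w from rfl,
      finprod_eq_prod_of_mulSupport_subset g hsubg]
    exact padicValNat_finsetProd_odd p SK g fun w _ => hg0 w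
  rw [hK', hg']
  refine Finset.sum_congr rfl fun w _ => ?_
  by_cases hcond : IsPlaceOverSplitConductorPrime W K w
  · rw [hg]; simp only [hcond, if_true]
  -- off `N⁺`: the factor `c_w(E_K)` is a `p`-unit
  rw [hg]; simp only [hcond, if_false, padicValNat_one_right]
  exact (padicValNat_localTamagawaNumber_baseChange_eq_zero_off_split W p K hp2 hmq hvq hK w
    hcond).symm

end TamQ

end Summit.BirchSwinnertonDyer.Rank1Residual.X11b.Three

end
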